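import Summits.HodgeConjecture.HodgeConjecture.Theorems.Ring2WeilCoverageCMTypeSignParity
import Literature.NumberTheory.ComplexMultiplication.CMTorusPolarizationType
import HarnessLib

/-!
# Weil-type family coverage — the unit-signature criterion for `Φ`-positive divisors of type `𝔣₀` on the
# principal CM tori `ℂ^Φ/D(𝔪)`, with the parity obstruction and the existence statement
# (kernel form of the census's b01.23 (A) Step 2 / THEOREM L (L-crit) mechanism)

research route conditional on HC_CM; not a corollary; Q11.4-sentence-2 already refuted in dim ≥ 3.

Ring 2, WEIL-TYPE FAMILY-COVERAGE CENSUS (`HOME/WEIL-FAMILY-COVERAGE.md` `## b01`, blocks b01.23 (A)–(B) and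
b01.28 THEOREM F / THEOREM L, owner ring2-b01), part 2 of `Ring2WeilCoverageCMTypeSignParity`.  The census
decides, for every simple CM abelian variety with CM by a cyclotomic maximal order and a `K`-balanced
(Weil-type) CM type, whether it carries a PRINCIPAL polarisation, by a two-step mechanism; this file proves the
mechanism in the tree's vocabulary for Shimura's polarized principal CM tori `(ℂ^Φ/D(𝔪), ι, X_ζ)` of type
`(K; Φ; 𝔣₀)` (`Literature.NumberTheory.ComplexMultiplication.CMTypeLattice.IsOfType 𝔪 ζ 𝔣₀`, i.e.
`𝔬𝔣₀ = ζ𝔡𝔪𝔪^ρ`; `𝔣₀ = 𝔬₀` is the principal case: `φ_X` is the `𝔬`-multiplication, `Ker φ_X = 0`), for an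
ARBITRARY CM field `K`, CM type `Φ`, lattice `𝔪` and type `𝔣₀`:

* §1 **Unit-signature criterion** (`exists_pos_isOfType_iff_exists_units`,
  `exists_pos_isOfType_iff_exists_realUnits`).  Fix ONE skew `ζ₀ ≠ 0` with `𝔬𝔣₀ = ζ₀𝔡𝔪𝔪^ρ` (no positivity
  asked).  Then `ℂ^Φ/D(𝔪)` carries a `Φ`-POSITIVE divisor `X_ζ` of type `𝔣₀` (`ζ^ρ = −ζ`, `Im ζ^φ > 0` on `Φ`)
  iff some unit `u` of `𝔬` fixed by `ρ` — equivalently a unit `v` of `𝔬₀ = 𝓞 K₀`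
  (Mathlib `IsCMField.Units.complexConj_eq_self_iff`) — has `Re u^φ · Im ζ₀^φ > 0` for every `φ ∈ Φ`: the sign
  vector of `u` at the real places under `Φ` equals the sign vector `s_Φ` of `ζ₀`.  (Shimura §14.3 Prop. 5: the
  divisors of type `𝔣₀` are the `X_{uζ₀}`, `u ∈ 𝔬ˣ`; `uζ₀` is skew iff `u ∈ K₀`.)  This is census b01.23 (A)
  Step 2 «`A_Φ` principally polarisable ⟺ `s_Φ ∈ Sig(L⁺)`» and the fixed-lattice case of THEOREM L (L-crit).
* §2 **Obstruction and existence** (`not_exists_pos_isOfType_of_prod_neg`, `…_of_odd`,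
  `…_of_odd_of_mod_two_eq`, `exists_pos_isOfType_of_even`): if every real unit has positive `Φ`-product
  `∏_{φ∈Φ} Re u^φ` (its norm to `ℚ` from `K₀`: «no unit of `K₀` of norm `−1`», THEOREM L (i) of the census —
  a HYPOTHESIS here) and `#{φ ∈ Φ : Im ζ₀^φ < 0}` is ODD, then NO `Φ`-positive divisor of type `𝔣₀` exists on
  `ℂ^Φ/D(𝔪)` (for `𝔣₀ = 𝔬₀`: no `ι`-compatible principal polarisation); by part 1's Φ-independence ONE odd
  type `Φ′` in the `Ψ`-balance class of `Φ` suffices (census: `Ψ = N_K`, all `K`-balanced classes of `(M, K)`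
  decided at once); if every EVEN sign pattern on `Φ` is the sign pattern of a real unit («`Sig(E⁺) =` the
  even hyperplane», THEOREM L (ii) — a HYPOTHESIS here) and the count is EVEN, such a divisor exists.

HONEST FRAMING.  Torus-level statements about Shimura's divisors `X_ζ` on principal CM tori (`ι`-compatible
polarisations; for a primitive `Φ` these are all polarisations, §14.1 Prop. 1 — not used); the two
class-field inputs of the census (norm `+1` of every unit of `ℚ(ζ_M)⁺` for `M` not a prime power; the
signature group is the even hyperplane when `h(ℚ(ζ_M)) = 1`) and the analytic input (F0) are NOT proved here
and enter only as the displayed hypotheses `hU` / `hU'` and the set `{φ : Im ζ₀^φ < 0}`.  No `def`, no named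
fact, no `sorry`; nothing here is a statement about Hodge classes; `HC_CM` is used nowhere.

References: [cite: Shimura1998, §14.3 Prop. 5, p. 104]; [cite: Shimura1998, §14.2 Prop. 2, p. 102];
[cite: Shimura1998, §14.3 Prop. 4, pp. 103–104].
-/

noncomputable section

open scoped Classical nonZeroDivisors NumberField ComplexConjugate
open NumberField NumberField.ComplexEmbedding Module FractionalIdeal Complex

namespace Summit.HodgeConjecture.Ring2WeilCoverage.CMUnitSignature

open Literature.AlgebraicGeometry.Motives (CMType)
open Literature.NumberTheory.ComplexMultiplication
open Literature.NumberTheory.ComplexMultiplication.CMTypeLattice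
open Summit.HodgeConjecture.Ring2WeilCoverage.CMTypeSignParity

variable {K : Type} [Field K] [NumberField K] [IsCMField K] (Φ : CMType K)
  (𝔪 : (FractionalIdeal (𝓞 K)⁰ K)ˣ) {ζ₀ : K} {𝔣₀ : Ideal (𝓞 (maximalRealSubfield K))}

/-! ### §1 The unit-signature criterion -/

omit [NumberField K] in
/-- A unit of `𝔬` is non-zero in `K`.
research route conditional on HC_CM; not a corollary; Q11.4-sentence-2 already refuted in dim ≥ 3. [folklore] -/
theorem coe_units_ne_zero (u : (𝓞 K)ˣ) : ((u : 𝓞 K) : K) ≠ 0 := fun h => by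
  have h' : (u : 𝓞 K) = 0 := by exact_mod_cast h
  exact u.ne_zero h'

/-- `Im (uζ₀)^φ = Re u^φ · Im ζ₀^φ` for a real `u`.
research route conditional on HC_CM; not a corollary; Q11.4-sentence-2 already refuted in dim ≥ 3. [cite: Shimura1998, §14.2 Prop. 2, p. 102] -/
theorem im_embedding_mul_of_real {u : K} (hu : IsCMField.complexConj K u = u) (ζ₀ : K) (φ : K →+* ℂ) :
    (φ (u * ζ₀)).im = (φ u).re * (φ ζ₀).im := by
  rw [map_mul, Complex.mul_im, im_embedding_eq_zero_of_complexConj_eq hu φ, zero_mul, add_zero]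

/-- **The unit-signature criterion** (census b01.23 (A) Step 2 «`A_Φ` principally polarisable ⟺
`s_Φ ∈ Sig(L⁺)`», for every type `𝔣₀`).  Let `ζ₀ ≠ 0` be skew with `𝔬𝔣₀ = ζ₀𝔡𝔪𝔪^ρ`
(`IsOfType 𝔪 ζ₀ 𝔣₀`; NO positivity asked — e.g. a skew generator of `(𝔡𝔪𝔪^ρ)⁻¹` for `𝔣₀ = 𝔬₀`).  Then the
principal CM torus `ℂ^Φ/D(𝔪)` carries a `Φ`-POSITIVE divisor `X_ζ` of type `(K; Φ; 𝔣₀)` — `ζ^ρ = −ζ`,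
`Im ζ^φ > 0` for `φ ∈ Φ`, `𝔬𝔣₀ = ζ𝔡𝔪𝔪^ρ`; by §14.3 Prop. 4 a polarisation whose `φ_X` is the
`𝔬𝔣₀`-multiplication, PRINCIPAL for `𝔣₀ = 𝔬₀` — iff some unit `u` of `𝔬` FIXED BY `ρ` has
`Re u^φ · Im ζ₀^φ > 0` for all `φ ∈ Φ` (the sign vector of `u` at the places under `Φ` is the sign vector
`s_Φ` of `ζ₀`).  Proof: the divisors of type `𝔣₀` are the `X_{uζ₀}`, `u ∈ 𝔬ˣ` (Prop. 5,
`isOfType_iff_exists_units_eq_mul`); `uζ₀` is skew iff `u^ρ = u`; `Im (uζ₀)^φ = Re u^φ · Im ζ₀^φ`.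
research route conditional on HC_CM; not a corollary; Q11.4-sentence-2 already refuted in dim ≥ 3. [cite: Shimura1998, §14.3 Prop. 5, p. 104] -/
theorem exists_pos_isOfType_iff_exists_units (hζ₀ : IsCMField.complexConj K ζ₀ = -ζ₀) (h0 : ζ₀ ≠ 0)
    (hT : IsOfType 𝔪 ζ₀ 𝔣₀) :
    (∃ ζ : K, IsCMField.complexConj K ζ = -ζ ∧ (∀ φ : Φ.1, 0 < (φ.1 ζ).im) ∧ IsOfType 𝔪 ζ 𝔣₀) ↔
      ∃ u : (𝓞 K)ˣ, IsCMField.complexConj K ((u : 𝓞 K) : K) = ((u : 𝓞 K) : K) ∧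
        ∀ φ : Φ.1, 0 < (φ.1 ((u : 𝓞 K) : K)).re * (φ.1 ζ₀).im := by
  constructor
  · rintro ⟨ζ, hζ, hpos, hTζ⟩
    obtain ⟨u, rfl⟩ := (isOfType_iff_exists_units_eq_mul 𝔪 hT).mp hTζ
    have hu : IsCMField.complexConj K ((u : 𝓞 K) : K) = ((u : 𝓞 K) : K) := by
      have h1 : IsCMField.complexConj K ((u : 𝓞 K) : K) * ζ₀ = ((u : 𝓞 K) : K) * ζ₀ := by
        have := hζ
        rw [map_mul, hζ₀, mul_neg, neg_inj] at this
        exact this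
      exact mul_right_cancel₀ h0 h1
    exact ⟨u, hu, fun φ => by rw [← im_embedding_mul_of_real hu ζ₀ φ.1]; exact hpos φ⟩
  · rintro ⟨u, hu, hpos⟩
    refine ⟨((u : 𝓞 K) : K) * ζ₀, ?_, fun φ => ?_,
      (isOfType_iff_exists_units_eq_mul 𝔪 hT).mpr ⟨u, rfl⟩⟩
    · rw [map_mul, hu, hζ₀, mul_neg]
    · rw [im_embedding_mul_of_real hu ζ₀ φ.1]; exact hpos φ

/-- **The same criterion with units of `𝔬₀ = 𝓞 K₀`** (`K₀ = maximalRealSubfield K`): the units of `𝔬` fixed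
by `ρ` are exactly the units of `𝔬₀` (Mathlib `IsCMField.Units.complexConj_eq_self_iff`), so `ℂ^Φ/D(𝔪)`
carries a `Φ`-positive divisor of type `𝔣₀` iff some `v ∈ 𝔬₀ˣ` has `Re v^φ · Im ζ₀^φ > 0` on `Φ` — the
census's «`s_Φ ∈ Sig(E⁺)`, `E⁺ =` the units of `L⁺`».
research route conditional on HC_CM; not a corollary; Q11.4-sentence-2 already refuted in dim ≥ 3. [cite: Shimura1998, §14.3 Prop. 5, p. 104] -/
theorem exists_pos_isOfType_iff_exists_realUnits (hζ₀ : IsCMField.complexConj K ζ₀ = -ζ₀) (h0 : ζ₀ ≠ 0)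
    (hT : IsOfType 𝔪 ζ₀ 𝔣₀) :
    (∃ ζ : K, IsCMField.complexConj K ζ = -ζ ∧ (∀ φ : Φ.1, 0 < (φ.1 ζ).im) ∧ IsOfType 𝔪 ζ 𝔣₀) ↔
      ∃ v : (𝓞 (maximalRealSubfield K))ˣ,
        ∀ φ : Φ.1, 0 < (φ.1 (algebraMap (𝓞 (maximalRealSubfield K)) K v)).re * (φ.1 ζ₀).im := by
  rw [exists_pos_isOfType_iff_exists_units Φ 𝔪 hζ₀ h0 hT]
  constructor
  · rintro ⟨u, hu, hpos⟩
    obtain ⟨v, hv⟩ := (IsCMField.Units.complexConj_eq_self_iff K u).mp hu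
    exact ⟨v, fun φ => by rw [hv]; exact hpos φ⟩
  · rintro ⟨v, hpos⟩
    refine ⟨Units.map (algebraMap (𝓞 (maximalRealSubfield K)) (𝓞 K)).toMonoidHom v, ?_, fun φ => ?_⟩
    · exact (IsCMField.Units.complexConj_eq_self_iff K _).mpr ⟨v, by
        simp [IsScalarTower.algebraMap_apply (𝓞 (maximalRealSubfield K)) (𝓞 K) K]⟩
    · have : (((Units.map (algebraMap (𝓞 (maximalRealSubfield K)) (𝓞 K)).toMonoidHom v : (𝓞 K)ˣ) :
          𝓞 K) : K) = algebraMap (𝓞 (maximalRealSubfield K)) K v := by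
        simp [IsScalarTower.algebraMap_apply (𝓞 (maximalRealSubfield K)) (𝓞 K) K]
      rw [this]; exact hpos φ

/-! ### §2 Obstruction and existence under the census's two class-field hypotheses -/

/-- **Product obstruction.**  If every unit of `𝔬` fixed by `ρ` has POSITIVE `Φ`-product `∏_{φ∈Φ} Re u^φ`
(«every unit of `K₀` has norm `+1`» — census THEOREM L (i), a hypothesis here) and `∏_{φ∈Φ} Im ζ₀^φ < 0`
for one (equivalently every) skew `ζ₀` with `𝔬𝔣₀ = ζ₀𝔡𝔪𝔪^ρ`, then `ℂ^Φ/D(𝔪)` carries NO `Φ`-positive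
divisor of type `𝔣₀` (for `𝔣₀ = 𝔬₀`: no `ι`-compatible principal polarisation).
research route conditional on HC_CM; not a corollary; Q11.4-sentence-2 already refuted in dim ≥ 3. [cite: Shimura1998, §14.3 Prop. 5, p. 104] -/
theorem not_exists_pos_isOfType_of_prod_neg (hζ₀ : IsCMField.complexConj K ζ₀ = -ζ₀) (h0 : ζ₀ ≠ 0)
    (hT : IsOfType 𝔪 ζ₀ 𝔣₀)
    (hU : ∀ u : (𝓞 K)ˣ, IsCMField.complexConj K ((u : 𝓞 K) : K) = ((u : 𝓞 K) : K) →
      0 < ∏ φ : Φ.1, (φ.1 ((u : 𝓞 K) : K)).re)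
    (hneg : ∏ φ : Φ.1, (φ.1 ζ₀).im < 0) :
    ¬ ∃ ζ : K, IsCMField.complexConj K ζ = -ζ ∧ (∀ φ : Φ.1, 0 < (φ.1 ζ).im) ∧ IsOfType 𝔪 ζ 𝔣₀ := by
  intro hex
  obtain ⟨u, hu, hpos⟩ := (exists_pos_isOfType_iff_exists_units Φ 𝔪 hζ₀ h0 hT).mp hex
  have h1 : 0 < ∏ φ : Φ.1, ((φ.1 ((u : 𝓞 K) : K)).re * (φ.1 ζ₀).im) :=
    Finset.prod_pos fun φ _ => hpos φ
  rw [Finset.prod_mul_distrib] at h1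
  have h2 := mul_neg_of_pos_of_neg (hU u hu) hneg
  linarith

/-- **Parity obstruction** (census NO-verdicts, kernel form): if every unit of `𝔬` fixed by `ρ` is negative
at an EVEN number of `φ ∈ Φ` and the skew `ζ₀` of type `𝔣₀` is negative at an ODD number of `φ ∈ Φ`
(`wt(s_Φ)` odd), then `ℂ^Φ/D(𝔪)` carries no `Φ`-positive divisor of type `𝔣₀`.
research route conditional on HC_CM; not a corollary; Q11.4-sentence-2 already refuted in dim ≥ 3. [cite: Shimura1998, §14.3 Prop. 5, p. 104] -/
theorem not_exists_pos_isOfType_of_odd (hζ₀ : IsCMField.complexConj K ζ₀ = -ζ₀) (h0 : ζ₀ ≠ 0)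
    (hT : IsOfType 𝔪 ζ₀ 𝔣₀)
    (hU : ∀ u : (𝓞 K)ˣ, IsCMField.complexConj K ((u : 𝓞 K) : K) = ((u : 𝓞 K) : K) →
      Even ((Φ.1 ∩ {ψ : K →+* ℂ | (ψ ((u : 𝓞 K) : K)).re < 0}).ncard))
    (hodd : Odd ((Φ.1 ∩ {ψ : K →+* ℂ | (ψ ζ₀).im < 0}).ncard)) :
    ¬ ∃ ζ : K, IsCMField.complexConj K ζ = -ζ ∧ (∀ φ : Φ.1, 0 < (φ.1 ζ).im) ∧ IsOfType 𝔪 ζ 𝔣₀ := by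
  refine not_exists_pos_isOfType_of_prod_neg Φ 𝔪 hζ₀ h0 hT (fun u hu => ?_) ?_
  · exact (prod_re_pos_iff_even hu (coe_units_ne_zero u) Φ).mpr (hU u hu)
  · have hne : ∏ φ : Φ.1, (φ.1 ζ₀).im ≠ 0 :=
      Finset.prod_ne_zero_iff.mpr fun φ _ => im_embedding_ne_zero_of_skew hζ₀ h0 φ.1
    have hnot : ¬ (0 < ∏ φ : Φ.1, (φ.1 ζ₀).im) := fun h =>
      (Nat.not_even_iff_odd.mpr hodd) ((prod_im_pos_iff_even hζ₀ h0 Φ).mp h)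
    exact lt_of_le_of_ne (not_lt.mp hnot) hne

/-- **Transported obstruction** (THEOREM F (F1) at work: ONE odd `K`-balanced type kills them all): under the
unit hypothesis for `Φ`, if some CM type `Φ′` in the same `Ψ`-parity class as `Φ` (`|Φ ∩ Ψ| ≡ |Φ′ ∩ Ψ|`) has
ODD `#{φ ∈ Φ′ : Im ζ₀^φ < 0}`, then `ℂ^Φ/D(𝔪)` carries no `Φ`-positive divisor of type `𝔣₀`.  (Census:
`Ψ = N_K`; all `K`-balanced classes of `(M, K)` are decided by one computation.)
research route conditional on HC_CM; not a corollary; Q11.4-sentence-2 already refuted in dim ≥ 3. [folklore] -/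
theorem not_exists_pos_isOfType_of_odd_of_mod_two_eq (hζ₀ : IsCMField.complexConj K ζ₀ = -ζ₀)
    (h0 : ζ₀ ≠ 0) (hT : IsOfType 𝔪 ζ₀ 𝔣₀)
    (hU : ∀ u : (𝓞 K)ˣ, IsCMField.complexConj K ((u : 𝓞 K) : K) = ((u : 𝓞 K) : K) →
      Even ((Φ.1 ∩ {ψ : K →+* ℂ | (ψ ((u : 𝓞 K) : K)).re < 0}).ncard))
    (Ψ Φ' : CMType K) (hbal : (Φ.1 ∩ Ψ.1).ncard % 2 = (Φ'.1 ∩ Ψ.1).ncard % 2)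
    (hodd : Odd ((Φ'.1 ∩ {ψ : K →+* ℂ | (ψ ζ₀).im < 0}).ncard)) :
    ¬ ∃ ζ : K, IsCMField.complexConj K ζ = -ζ ∧ (∀ φ : Φ.1, 0 < (φ.1 ζ).im) ∧ IsOfType 𝔪 ζ 𝔣₀ := by
  refine not_exists_pos_isOfType_of_odd Φ 𝔪 hζ₀ h0 hT hU ?_
  rw [Nat.odd_iff] at hodd ⊢
  rw [ncard_negSet_mod_two_eq_of_mod_two_eq hζ₀ h0 Ψ Φ Φ' hbal]
  exact hodd

/-- **Existence under the signature hypothesis** (census YES-verdicts, kernel form): if every EVEN sign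
pattern on `Φ` is the sign pattern of a unit of `𝔬` fixed by `ρ` («`Sig(E⁺) =` the even-weight
hyperplane», census THEOREM L (ii) — a hypothesis here) and the skew `ζ₀` of type `𝔣₀` is negative at an
EVEN number of `φ ∈ Φ`, then `ℂ^Φ/D(𝔪)` carries a `Φ`-positive divisor of type `𝔣₀` (a principal
polarisation for `𝔣₀ = 𝔬₀`): take `u` with the sign pattern of `ζ₀` and `ζ = uζ₀`.
research route conditional on HC_CM; not a corollary; Q11.4-sentence-2 already refuted in dim ≥ 3. [cite: Shimura1998, §14.3 Prop. 5, p. 104] -/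
theorem exists_pos_isOfType_of_even (hζ₀ : IsCMField.complexConj K ζ₀ = -ζ₀) (h0 : ζ₀ ≠ 0)
    (hT : IsOfType 𝔪 ζ₀ 𝔣₀)
    (hU' : ∀ S : Set (K →+* ℂ), S ⊆ Φ.1 → Even S.ncard →
      ∃ u : (𝓞 K)ˣ, IsCMField.complexConj K ((u : 𝓞 K) : K) = ((u : 𝓞 K) : K) ∧
        ∀ φ ∈ Φ.1, ((φ ((u : 𝓞 K) : K)).re < 0 ↔ φ ∈ S))
    (heven : Even ((Φ.1 ∩ {ψ : K →+* ℂ | (ψ ζ₀).im < 0}).ncard)) :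
    ∃ ζ : K, IsCMField.complexConj K ζ = -ζ ∧ (∀ φ : Φ.1, 0 < (φ.1 ζ).im) ∧ IsOfType 𝔪 ζ 𝔣₀ := by
  obtain ⟨u, hu, hsign⟩ := hU' (Φ.1 ∩ {ψ : K →+* ℂ | (ψ ζ₀).im < 0}) Set.inter_subset_left heven
  refine (exists_pos_isOfType_iff_exists_units Φ 𝔪 hζ₀ h0 hT).mpr ⟨u, hu, fun φ => ?_⟩
  have hre := re_embedding_ne_zero_of_real hu (coe_units_ne_zero u) φ.1
  have him := im_embedding_ne_zero_of_skew hζ₀ h0 φ.1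
  have hiff : (φ.1 ((u : 𝓞 K) : K)).re < 0 ↔ (φ.1 ζ₀).im < 0 := by
    rw [hsign φ.1 φ.2]
    simp only [Set.mem_inter_iff, Set.mem_setOf_eq]
    exact ⟨fun h => h.2, fun h => ⟨φ.2, h⟩⟩
  rcases lt_or_gt_of_ne him with hlt | hgt
  · exact mul_pos_of_neg_of_neg (hiff.mpr hlt) hlt
  · have hre' : 0 < (φ.1 ((u : 𝓞 K) : K)).re :=
      lt_of_le_of_ne (not_lt.mp fun h => (lt_asymm (hiff.mp h)) hgt) hre.symm
    exact mul_pos hre' hgt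


/-! ### §3 The `Φ`-product of a real element is its norm from `K₀`; the obstruction under «no unit of norm `−1`» -/

omit [IsCMField K] in
/-- `#Φ = #(K₀ →+* ℂ)`: a CM type has `[K⁺ : ℚ] = [K : ℚ]/2` elements (`2·#Φ = [K : ℚ]`,
`CMTypeLattice.two_mul_card_eq_finrank`; `[K : K⁺] = 2`).
research route conditional on HC_CM; not a corollary; Q11.4-sentence-2 already refuted in dim ≥ 3. [cite: Shimura1998, §5.2 Thm. 1 (CM1), p. 40] -/
theorem card_eq_card_embeddings_maximalRealSubfield [IsCMField K] :
    Fintype.card Φ.1 = Fintype.card (maximalRealSubfield K →+* ℂ) := by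
  rw [NumberField.Embeddings.card]
  have h1 := Module.finrank_mul_finrank ℚ (maximalRealSubfield K) K
  rw [Algebra.IsQuadraticExtension.finrank_eq_two (maximalRealSubfield K) K,
    ← two_mul_card_eq_finrank Φ] at h1
  omega

/-- **Restriction to `K₀` is injective on a CM type**: two elements of `Φ` with the same restriction to
`K⁺` define the same infinite place of `K` (the places of `K` and `K⁺` correspond, Mathlib
`IsCMField.equivInfinitePlace`), hence are equal or conjugate — and `Φ` never contains a conjugate pair.
research route conditional on HC_CM; not a corollary; Q11.4-sentence-2 already refuted in dim ≥ 3. [cite: Shimura1998, §5.2 Thm. 1 (CM1), p. 40] -/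
theorem comp_algebraMap_injective :
    Function.Injective fun φ : Φ.1 => φ.1.comp (algebraMap (maximalRealSubfield K) K) := by
  intro φ ψ h
  have h' : φ.1.comp (algebraMap (maximalRealSubfield K) K) =
      ψ.1.comp (algebraMap (maximalRealSubfield K) K) := h
  have hw : InfinitePlace.mk φ.1 = InfinitePlace.mk ψ.1 := by
    apply (IsCMField.equivInfinitePlace K).injective
    rw [IsCMField.equivInfinitePlace_apply, IsCMField.equivInfinitePlace_apply,
      InfinitePlace.comap_mk, InfinitePlace.comap_mk, h']
  rcases InfinitePlace.mk_eq_iff.mp hw with h1 | h2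
  · exact Subtype.ext h1
  · exact absurd (h2 ▸ ψ.2 : conjugate φ.1 ∈ Φ.1) ((Φ.2 φ.1).mp φ.2)

/-- **`Φ ≃ Hom(K₀, ℂ)` by restriction** (injective and of the right cardinality): the elements of a CM type
are in bijection with the (real) embeddings of the maximal real subfield — «the real places under `Φ`».
research route conditional on HC_CM; not a corollary; Q11.4-sentence-2 already refuted in dim ≥ 3. [cite: Shimura1998, §5.2 Thm. 1 (CM1), p. 40] -/
theorem comp_algebraMap_bijective :
    Function.Bijective fun φ : Φ.1 => φ.1.comp (algebraMap (maximalRealSubfield K) K) :=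
  (Fintype.bijective_iff_injective_and_card _).mpr
    ⟨comp_algebraMap_injective Φ, card_eq_card_embeddings_maximalRealSubfield Φ⟩

/-- **The `Φ`-product of an element of `K₀` is its norm**: `∏_{φ ∈ Φ} x^φ = N_{K₀/ℚ}(x)` in `ℂ`
(Mathlib `Algebra.norm_eq_prod_embeddings` over `Hom(K₀, ℂ) ≃ Φ`).
research route conditional on HC_CM; not a corollary; Q11.4-sentence-2 already refuted in dim ≥ 3. [folklore] -/
theorem prod_embedding_algebraMap_eq_norm (x : maximalRealSubfield K) :
    ∏ φ : Φ.1, φ.1 (algebraMap (maximalRealSubfield K) K x) = algebraMap ℚ ℂ (Algebra.norm ℚ x) := by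
  rw [Algebra.norm_eq_prod_embeddings ℚ ℂ]
  refine Fintype.prod_equiv ((Equiv.ofBijective _ (comp_algebraMap_bijective Φ)).trans
    (RingHom.equivRatAlgHom)) _ _ (fun φ => ?_)
  simp [RingHom.equivRatAlgHom]

/-- **Real form**: `∏_{φ ∈ Φ} Re x^φ = N_{K₀/ℚ}(x)` for `x ∈ K₀` (each `x^φ` is real).  So the hypothesis
«every real unit has positive `Φ`-product» of §2 reads «every unit of `K₀` has norm `+1`» — census
THEOREM L (i) (there: a theorem of class field theory for `ℚ(ζ_M)⁺`, `M` not a prime power).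
research route conditional on HC_CM; not a corollary; Q11.4-sentence-2 already refuted in dim ≥ 3. [folklore] -/
theorem prod_re_embedding_algebraMap_eq_norm (x : maximalRealSubfield K) :
    ∏ φ : Φ.1, (φ.1 (algebraMap (maximalRealSubfield K) K x)).re = (Algebra.norm ℚ x : ℝ) := by
  have hreal : ∀ φ : Φ.1, φ.1 (algebraMap (maximalRealSubfield K) K x) =
      (((φ.1 (algebraMap (maximalRealSubfield K) K x)).re : ℝ) : ℂ) := fun φ =>
    Complex.ext (by simp) (by
      rw [Complex.ofReal_im]
      exact im_embedding_eq_zero_of_complexConj_eq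
        ((IsCMField.complexConj_eq_self_iff K _).mpr x.2) φ.1)
  have h := prod_embedding_algebraMap_eq_norm Φ x
  rw [Finset.prod_congr rfl (fun φ _ => hreal φ), ← Complex.ofReal_prod] at h
  have h2 : (algebraMap ℚ ℂ) (Algebra.norm ℚ x) = (((Algebra.norm ℚ x : ℚ) : ℝ) : ℂ) := by
    rw [Complex.ofReal_ratCast]; rfl
  rw [h2] at h
  exact_mod_cast h

/-- **Obstruction under «no unit of `K₀` of norm `−1`»** (the census's NO-verdicts as used: THEOREM L (i) +
odd `wt(s_Φ)`): if every unit `v` of `𝔬₀ = 𝓞 K₀` has `N_{K₀/ℚ}(v) > 0` and the skew `ζ₀` of type `𝔣₀` on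
`D(𝔪)` is negative at an ODD number of `φ ∈ Φ`, then `ℂ^Φ/D(𝔪)` carries no `Φ`-positive divisor of type
`𝔣₀` (for `𝔣₀ = 𝔬₀`: the CM pair `(ℂ^Φ/D(𝔪), ι)` is not principally polarisable).
research route conditional on HC_CM; not a corollary; Q11.4-sentence-2 already refuted in dim ≥ 3. [cite: Shimura1998, §14.3 Prop. 5, p. 104] -/
theorem not_exists_pos_isOfType_of_norm_pos_of_odd (hζ₀ : IsCMField.complexConj K ζ₀ = -ζ₀) (h0 : ζ₀ ≠ 0)
    (hT : IsOfType 𝔪 ζ₀ 𝔣₀)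
    (hN : ∀ v : (𝓞 (maximalRealSubfield K))ˣ,
      0 < Algebra.norm ℚ (((v : 𝓞 (maximalRealSubfield K)) : maximalRealSubfield K)))
    (hodd : Odd ((Φ.1 ∩ {ψ : K →+* ℂ | (ψ ζ₀).im < 0}).ncard)) :
    ¬ ∃ ζ : K, IsCMField.complexConj K ζ = -ζ ∧ (∀ φ : Φ.1, 0 < (φ.1 ζ).im) ∧ IsOfType 𝔪 ζ 𝔣₀ := by
  refine not_exists_pos_isOfType_of_prod_neg Φ 𝔪 hζ₀ h0 hT (fun u hu => ?_) ?_
  · obtain ⟨v, hv⟩ := (IsCMField.Units.complexConj_eq_self_iff K u).mp hu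
    have h1 : (algebraMap (𝓞 K) K) (u : 𝓞 K) = ((u : 𝓞 K) : K) := rfl
    have hv' : ((u : 𝓞 K) : K) =
        algebraMap (maximalRealSubfield K) K ((v : 𝓞 (maximalRealSubfield K)) : maximalRealSubfield K) := by
      rw [← h1, ← hv, IsScalarTower.algebraMap_apply (𝓞 (maximalRealSubfield K)) (maximalRealSubfield K) K]
    simp_rw [hv']
    rw [prod_re_embedding_algebraMap_eq_norm Φ]
    exact_mod_cast hN v
  · have hne : ∏ φ : Φ.1, (φ.1 ζ₀).im ≠ 0 :=
      Finset.prod_ne_zero_iff.mpr fun φ _ => im_embedding_ne_zero_of_skew hζ₀ h0 φ.1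
    have hnot : ¬ (0 < ∏ φ : Φ.1, (φ.1 ζ₀).im) := fun h =>
      (Nat.not_even_iff_odd.mpr hodd) ((prod_im_pos_iff_even hζ₀ h0 Φ).mp h)
    exact lt_of_le_of_ne (not_lt.mp hnot) hne

/-- **Transported form** (one odd `K`-balanced type kills every `K`-balanced type, part 1's
Φ-independence): under «no unit of `K₀` of norm `−1`», if a CM type `Φ′` with `|Φ ∩ Ψ| ≡ |Φ′ ∩ Ψ| (mod 2)`
has odd `#{φ ∈ Φ′ : Im ζ₀^φ < 0}`, then `ℂ^Φ/D(𝔪)` carries no `Φ`-positive divisor of type `𝔣₀`.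
research route conditional on HC_CM; not a corollary; Q11.4-sentence-2 already refuted in dim ≥ 3. [folklore] -/
theorem not_exists_pos_isOfType_of_norm_pos_of_odd_of_mod_two_eq
    (hζ₀ : IsCMField.complexConj K ζ₀ = -ζ₀) (h0 : ζ₀ ≠ 0) (hT : IsOfType 𝔪 ζ₀ 𝔣₀)
    (hN : ∀ v : (𝓞 (maximalRealSubfield K))ˣ,
      0 < Algebra.norm ℚ (((v : 𝓞 (maximalRealSubfield K)) : maximalRealSubfield K)))
    (Ψ Φ' : CMType K) (hbal : (Φ.1 ∩ Ψ.1).ncard % 2 = (Φ'.1 ∩ Ψ.1).ncard % 2)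
    (hodd : Odd ((Φ'.1 ∩ {ψ : K →+* ℂ | (ψ ζ₀).im < 0}).ncard)) :
    ¬ ∃ ζ : K, IsCMField.complexConj K ζ = -ζ ∧ (∀ φ : Φ.1, 0 < (φ.1 ζ).im) ∧ IsOfType 𝔪 ζ 𝔣₀ := by
  refine not_exists_pos_isOfType_of_norm_pos_of_odd Φ 𝔪 hζ₀ h0 hT hN ?_
  rw [Nat.odd_iff] at hodd ⊢
  rw [ncard_negSet_mod_two_eq_of_mod_two_eq hζ₀ h0 Ψ Φ Φ' hbal]
  exact hodd

end Summit.HodgeConjecture.Ring2WeilCoverage.CMUnitSignature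

end
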